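import Summits.BirchSwinnertonDyer.BirchSwinnertonDyer.Theorems.ErratumRoadFiveKatoFframeLambdaAssembly
import Summits.BirchSwinnertonDyer.BirchSwinnertonDyer.Theorems.ErratumRoadFiveKatoFframeLocalTowerTorsionFiniteMult
import Summits.BirchSwinnertonDyer.BirchSwinnertonDyer.Theorems.ErratumRoadFiveKatoFframeALineIndex
import Summits.BirchSwinnertonDyer.BirchSwinnertonDyer.Theorems.ErratumRoadFiveKatoFframeStrictSelmerCountMult
import Summits.BirchSwinnertonDyer.Rank1Residual.Additive.KatoDescentRankOneCountOfH2Count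
import Summits.BirchSwinnertonDyer.Rank1Residual.Additive.KatoDescentGlobalKummerLattice
import Summits.BirchSwinnertonDyer.Rank1Residual.Additive.BudgetFromRationalClasses
import Literature.NumberTheory.EllipticCurves.Kato2004.AdmissibleZetaClassLengthInequality
import Literature.NumberTheory.EllipticCurves.Kato2004.IwasawaH2FineSelmerDualCountRankFree
import Literature.NumberTheory.EllipticCurves.Kato2004.Condition1252SemistableProofs
import Literature.NumberTheory.EllipticCurves.LeadingTerm
import HarnessLib

/-!
# Route `ErratumRoadFive`, crux `EulerHalfNotRamNoInertSetAtFive` (stmt-BirchSwinnertonDyer-19715), line `kato_Fframe`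
# (registered r5.2 cf457b9468bcf978; r5.4 candidate 3e8aa5467f42b525), stub S1Λ `stub_katoLambdaLogBoundTamagawa` —
# **S1Λ PROVED ON THE SUB-CLASS «every bad prime `ℓ ≠ p` is ADDITIVE»** (the `p`-only-multiplicative pairs: 334 of the 404
# `ρ̄`-onto census pairs of 19715), modulo the three named facts of the r5.4 cite stub S0 (GZK, Kato Thm. 12.5 (4) = F1′,
# Kato (14.9.3)+(14.14.2) = H2Xʳ): the r5.4 signature of S1Λ VERBATIM with ONE extra leading hypothesis on `W`

LEAD seat `bsd-line-er5-p1` (g8), `--supports stmt-BirchSwinnertonDyer-19715`; theorems only (no definition, no named fact, no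
`sorry`); nothing here closes the registered stub (which quantifies over the whole class: bad multiplicative `ℓ ≠ p` allowed — that
needs R-C, the (R1-d) local index at a multiplicative `ℓ ∤ p`) or 19715. PURPOSE (LEAD ruling 2026-08-30 ≈06:3xZ): run the WHOLE
kernel chain of S1Λ end to end today — every glue step (instance diamonds, binder order, the three facts' consumer shapes) — so
that the final closer is this file with `hadd` discharged by R-C. HONEST FRAMING: no summit statement is proved; a named fact is a
hypothesis; BSD is proved for no curve.

## The chain (all links tree theorems; facts by name)

GZK ⟹ `Finite Ш(W)`; `Surj` ⟹ `Irr` ⟹ `p ∤ #W(ℚ)_tors` (`Additive.not_dvd_torsionOrder_of_surj`) ⟹ `#W(ℚ)[p^∞] = 1`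
(`StrictCount.natCard_primaryComponent_point_eq_one_of_not_dvd_torsionOrder`); `Surj`, `p ≥ 5` ⟹ (12.5.2)
(`Kato2004.imageContainsSL2_of_surj_of_five_le_or_semistable`); `p ∥ N`, `p ≥ 5`, `κ` cyclotomic ⟹ `W(ℚ_{p,∞})[p^∞]` finite
(R-fin, `…LocalTowerTorsionFiniteMult`, p763449); F1′ at `z₀` ⟹ `hlen`; H2Xʳ ⟹ `(J, e, he, hcok, hcount)`
(`.exists_count_of_finite_coinvariants`); the Mordell–Weil generator `x̂ = P 0` generates modulo torsion; its `T_p`-adic Kummer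
class `κ_∞(x̂)` (`GlobalKummer.exists_forall_ofTopSubgroup_reduceH1Pk_eq_kummerMapTorsion`) spans `H¹(ℤ[1/p],T_pW) = ℤ_p·p^a κ_∞(x̂)`
(`GlobalKummer.exists_integralH1_eq_span_pow_smul`); L3′ (`…ALineIndex.padicValNat_card_quotient_span_proj_le`, p763900-series) ⟹
`hindex`; the bad places `≠ v_p`, all additive (`StrictCount.exists_finset_badPlaces_ne`) ⟹ R-D
(`…StrictSelmerCountMult.finite_katoStrictSelmer_and_padicValNat_card_eq_of_mult`, p763770) ⟹ `hstrict`; ASSEMBLY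
(`…LambdaAssembly.katoLambdaLogBound_of_counts`, p763745) ⟹ the registered `∀ (m, Q₀, Q)` body.

References: [Kato2004Asterisque] Thm. 12.5 (4) (p. 222), (14.9.3) (p. 240), §14.14 (pp. 243–244); [GreenbergLNM1716] §3–§4;
[Darmon2004] Thm. 3.22 (GZK); [SilvermanAEC2009] IV.6.4, VII.6, VIII.§2; [Mazur1977] III.§5.
-/

-- the summit and its single problem are both named `BirchSwinnertonDyer` (registry layout D-0017)
set_option linter.dupNamespace false
set_option autoImplicit false

noncomputable section

open scoped Classical NumberField
open Field IsDedekindDomain WeierstrassCurve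
open Literature.NumberTheory.EllipticCurves Literature.NumberTheory.EllipticCurves.Kato2004
open Literature.NumberTheory.EllipticCurves.Kato2004.EulerSystemValues
open Literature.NumberTheory.EllipticCurves.IwasawaAlgebra
open Literature.NumberTheory.EllipticCurves.Rank1Residual
open Literature.NumberTheory.GaloisRepresentations
open Summit.BirchSwinnertonDyer.Rank1Residual
open Summit.BirchSwinnertonDyer.Rank1Residual.Additive

namespace Summit.BirchSwinnertonDyer.BirchSwinnertonDyer.Theorems.ErratumRoadFiveKatoFframeS1LambdaOfAllBadAdditive

/-! ## §1 Glue -/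

section Glue

variable {F : Type*} [Field F] (W : WeierstrassCurve F)

/-- **Coordinates along a rank-one Mordell–Weil basis** indexed by `Fin (rank W(F))` with `rank = 1`: every `Q ∈ W(F)` is
`n • P 0` modulo torsion (any field `F`; stated with the classical `DecidableEq`, as `IsMordellWeilBasis` is — at `F = ℚ`
the consumer re-bases it by `convert`). [cite: SilvermanAEC2009, Thm. VIII.6.7] -/
theorem exists_sub_zsmul_isOfFinAddOrder_of_isMordellWeilBasis (h1 : W.mordellWeilRank = 1)
    {P : Fin W.mordellWeilRank → W.toAffine.Point} (hP : W.IsMordellWeilBasis P) (Q : W.toAffine.Point) :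
    ∃ n : ℤ, IsOfFinAddOrder (Q - n • P (Fin.cast h1.symm 0)) := by
  set i₀ : Fin W.mordellWeilRank := Fin.cast h1.symm 0 with hi₀
  have hi : ∀ i : Fin W.mordellWeilRank, i = i₀ := fun i ↦ Fin.ext (by
    have h := i.2
    rw [hi₀, Fin.val_cast, Fin.val_zero]
    omega)
  have hrange : Set.range (QuotientAddGroup.mk ∘ P : Fin W.mordellWeilRank → mordellWeilModTorsion W) =
      {QuotientAddGroup.mk (P i₀)} := by
    ext z
    simp only [Set.mem_range, Set.mem_singleton_iff, Function.comp_apply]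
    exact ⟨by rintro ⟨i, rfl⟩; rw [hi i], by rintro rfl; exact ⟨i₀, rfl⟩⟩
  have hQ : (QuotientAddGroup.mk Q : mordellWeilModTorsion W) ∈
      Submodule.span ℤ (Set.range (QuotientAddGroup.mk ∘ P : Fin W.mordellWeilRank → mordellWeilModTorsion W)) := by
    rw [hP.2]; trivial
  rw [hrange, Submodule.mem_span_singleton] at hQ
  obtain ⟨n, hn⟩ := hQ
  refine ⟨n, ?_⟩
  rw [← AddCommGroup.mem_torsion, ← QuotientAddGroup.eq_zero_iff, QuotientAddGroup.mk_sub,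
    QuotientAddGroup.mk_zsmul, ← hn, sub_self]

end Glue

/-! ## §2 S1Λ on the sub-class «every bad `ℓ ≠ p` additive» -/

/-- **S1Λ (`stub_katoLambdaLogBoundTamagawa`, r5.4 signature) on the sub-class where every bad prime `ℓ ≠ p` of `W` is
ADDITIVE** — modulo the three named facts GZK, F1′ (Kato Thm. 12.5 (4), fine form) and H2Xʳ (Kato (14.9.3) + (14.14.2)):
for `p ≥ 5`, `ρ̄_{W,p}` onto, `r_an(W) = 1`, `p` multiplicative, a Mordell–Weil basis `P`, the cyclotomic `(K, γ)`, a pinned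
`𝐇¹_Γ(T_pW)` with an ADMISSIBLE `z₀` whose bottom layer has Kummer logarithm `t ≠ 0`, every `m`, every local `Q₀` of order `p^m`
and every local `Q` with `log_ω Q ≠ 0`:
`ord_p #Ш + ord_p log_ω x̂ − ord_p log_ω Q + ((ord_p ∏c_ℓ − ord_p c_p) + m) ≤ ord_p t − ord_p log_ω x̂`, `x̂ = P 0`.
After the extra hypothesis `hadd` the statement is the r5.4 stub VERBATIM (with the skeleton's `bottomClass`/`logOmega` unfolded).
[cite: Kato2004Asterisque, Thm. 12.4 (3), Thm. 12.5 (4) (pp. 221–222), (14.9.3) (p. 240), §14.14 (pp. 243–244)]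
[cite: GreenbergLNM1716, §3 Lemma 3.3 and p. 88, §4 Lemma 4.2] [cite: Darmon2004, Thm. 3.22] -/
theorem katoLambdaLogBoundTamagawa_of_allBadAdditive
    (hGZK : rank_eq_analyticRank_of_analyticRank_le_one)
    (hF1 : lengthAt_fineSelmerDual_le_of_isAdmissibleZetaClass)
    (hH2X : exists_iwasawaH2Data_fineSelmerDual_embedding_countRankFree) :
    ∀ (W : WeierstrassCurve ℚ) [W.IsElliptic] [W.IsGloballyMinimal] (p : ℕ) [Fact p.Prime]
      [ContinuousSMul ℤ_[p] (W.tateModule p)],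
      (∀ v ∈ W.badPlaces (𝓞 ℚ), ((Rat.HeightOneSpectrum.primesEquiv v : Nat.Primes) : ℕ) ≠ p →
        W.HasAdditiveReductionAt v) →
      5 ≤ p → Surj W p → W.analyticRank = 1 → W.HasMultiplicativeReductionAtPrime p →
      ∀ (h1 : W.mordellWeilRank = 1) (P : Fin W.mordellWeilRank → W.toAffine.Point),
        W.IsMordellWeilBasis P →
      ∀ (K : ZpExtension ℚ p) (hK : K.IsCyclotomic) (γ : absoluteGaloisGroup ℚ)
        (I : IwasawaH1Data W p K γ) (z₀ : I.H), K.IsTopGenerator γ → IsAdmissibleZetaClass W p K hK I z₀ →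
      ∀ t : ℚ_[p], HasLocPKummerLog W p (layerZeroToTop W p K (I.proj 0 z₀)) t → t ≠ 0 →
      ∀ (m : ℕ) (Q₀ : (W.baseChange ℚ_[p]).toAffine.Point), addOrderOf Q₀ = p ^ m →
      ∀ Q : (W.baseChange ℚ_[p]).toAffine.Point, padicLogLocal W p Q ≠ 0 →
        (padicValNat p W.shaOrder : ℤ) +
              (padicLogLocal W p (WeierstrassCurve.Affine.Point.map (Algebra.ofId ℚ ℚ_[p]) (P (Fin.cast h1.symm 0)))).valuation
            - (padicLogLocal W p Q).valuation
            + (((padicValNat p W.tamagawaProduct : ℤ)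
                - padicValNat p ((W.baseChange ℚ_[p]).localTamagawaNumber ℤ_[p])) + m) ≤
          t.valuation -
            (padicLogLocal W p (WeierstrassCurve.Affine.Point.map (Algebra.ofId ℚ ℚ_[p]) (P (Fin.cast h1.symm 0)))).valuation := by
  intro W _ _ p _ _ hadd h5 hsurj hr1 hmult h1 P hP K hK γ I z₀ hγ hz t ht ht0
  have hpP : p.Prime := Fact.out
  have hp2 : p ≠ 2 := by omega
  have hp3 : 3 ≤ p := by omega
  -- GZK: `Ш(W)` is finite
  have hshafin : Finite W.sha := (hGZK W (le_of_eq hr1)).2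
  haveI := hshafin
  have hsha : Finite (AddCommGroup.primaryComponent W.sha p) := inferInstance
  -- `ρ̄` onto ⟹ `p ∤ #W(ℚ)_tors` ⟹ `#W(ℚ)[p^∞] = 1`; and (12.5.2)
  have htors : ¬ p ∣ W.torsionOrder := not_dvd_torsionOrder_of_surj p W hsurj
  have hW1 : Nat.card (AddCommGroup.primaryComponent W.toAffine.Point p) = 1 := by
    convert StrictCount.natCard_primaryComponent_point_eq_one_of_not_dvd_torsionOrder W p htors
  have hSL : ImageContainsSL2 W p := imageContainsSL2_of_surj_of_five_le_or_semistable W p hp2 (Or.inl h5) hsurj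
  -- R-fin: `W(ℚ_{p,∞})[p^∞]` is finite at the multiplicative `p`
  have hfin := ErratumRoadFiveKatoFframeLocalTowerTorsionFiniteMult.finite_fixedPoints_kerSubgroup_inf_decomp_of_multiplicative
    W p hp3 hmult K hK (primePlace p) (coe_primesEquiv_primePlace p)
  -- F1′ at `z₀`
  have hlen := hF1 W p K γ hK hγ (primePlace p) hp2 hSL (coe_primesEquiv_primePlace p) hfin I z₀ hz
  -- H2Xʳ: the package `J ⊇ X₀` with its count
  obtain ⟨J, e, he, hcok, hcount⟩ :=
    hH2X.exists_count_of_finite_coinvariants (W := W) (p := p) (κ := K) (γ := γ) hγ (primePlace p) hp2 hK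
      (coe_primesEquiv_primePlace p) hfin I
  -- the Mordell–Weil generator and its `T_p`-adic Kummer class
  -- (§1 carries the classical `DecidableEq` on `W(ℚ)`, as `IsMordellWeilBasis` does; `convert` re-bases it on the `ℚ` instance)
  have hgen : ∀ R : W.toAffine.Point, ∃ n : ℤ, IsOfFinAddOrder (R - n • P (Fin.cast h1.symm 0)) := fun R ↦ by
    obtain ⟨n, hn⟩ := exists_sub_zsmul_isOfFinAddOrder_of_isMordellWeilBasis W h1 hP R
    exact ⟨n, by convert hn⟩
  obtain ⟨x, hx⟩ := GlobalKummer.exists_forall_ofTopSubgroup_reduceH1Pk_eq_kummerMapTorsion W p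
    (GlobalKummer.zsmul_pow_surjective W p) (P (Fin.cast h1.symm 0))
  obtain ⟨a, ha, -⟩ := GlobalKummer.exists_integralH1_eq_span_pow_smul W p h1 hsha htors hgen hx
  -- L3′: the A-line index
  have hindex := ErratumRoadFiveKatoFframeALineIndex.padicValNat_card_quotient_span_proj_le W p K γ h1 hsha htors hgen hx
    ha I z₀ ht ht0
  -- the bad places `≠ v_p` (all additive) and R-D: the strict Selmer count at the multiplicative `p`
  obtain ⟨Qs, hQp, hQadd, hQbad⟩ := StrictCount.exists_finset_badPlaces_ne W p hadd
  obtain ⟨-, hstrict⟩ :=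
    ErratumRoadFiveKatoFframeStrictSelmerCountMult.finite_katoStrictSelmer_and_padicValNat_card_eq_of_mult W p hp2 hmult
      h1 hsha htors hgen hx Qs hQp hQadd hQbad ha
  -- assembly
  exact ErratumRoadFiveKatoFframeLambdaAssembly.katoLambdaLogBound_of_counts W p hmult h1 hshafin hW1
    (P (Fin.cast h1.symm 0)) K hK γ hγ I z₀ t ht ht0 hlen J e he hcok hcount a hindex hstrict

end Summit.BirchSwinnertonDyer.BirchSwinnertonDyer.Theorems.ErratumRoadFiveKatoFframeS1LambdaOfAllBadAdditive

end
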